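import Summits.CriticalPhenomena.PercolationContinuityZ3.Theorems.Transplant.SkelPhiRouteChain2
import Summits.CriticalPhenomena.PercolationContinuityZ3.Theorems.Transplant.SkelPhiRouteLawF
import Summits.CriticalPhenomena.PercolationContinuityZ3.Theorems.Transplant.SkelPhiRootBridgeGeom
import Summits.CriticalPhenomena.PercolationContinuityZ3.Theorems.Transplant.KNParaRootBridge
import HarnessLib

/-!
# N1 ({±1} node), (F) inner route, part R3b (hp-8 g33): **THE ROUTE DATUM (h3) OF A FACE-STEP KIT FROM THE BRIDGE AND A BAND AT THE KIT CENTRE**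
# — the (F) twin of p3-g9's `rootOblTWAt_of_bridge` (SkelPhiRootChainN) under hp-8 g24's route law `Skel.routeW`: at a near contact's kit centre `c`
# of the face step (law `Wt`, a subbox weighting of `winGraph G w₀ Rπ` on the region `D`, true target `T`, zone `Z`), the kit's wired seed `S ∋ c`,
# the HOP (a `P_q` link from a sub-seed into the bridge's landing box, read in `rootFrame φ c σ`), ONE BRIDGE STEP (p3-g9's `BridgePrm.bridgeFrame`
# read in `rootFrame φ c σ`, clearing the seed) and a BAND (any schedule frame `S₂` read through any Lipschitz map `ψL`, e.g. a run frame at `c`)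
# whose regions have CELL FOOTPRINTS in a planar set `Pl` with `Win ψc w₀ Pl Rπ ⊆ D` and whose last core has footprints in a target window `MM ⊆ T`
# off the zone, give `∃ Qt Ft, Ft ⊆ T ∧ Qt ⊆ D ∧ Disjoint Ft Z ∧ 1 − ε < P_{Wt}(linkIn Qt S Ft)` — the (h3) input of p1-g11's `kitClauseA'`
# (my `kitClause_frame`).  Geometry enters only through footprint hypotheses (p3-g9 16:27:10Z (b): the (R4d) readings are parametric in the box).

builds on p205010 (kernel theorem, internal audit signed; external expert review pending) — nothing in this file uses p205010; nothing here is a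
claim about the open node `SamePDropOfSkeletonNeg`.
Lane `prim-bschramm`, seat `prim-hp-8` (gen 33); helper file (`--supports stmt-CriticalPhenomena-4575 --as helper`).
* **`Skelφ.faceRoute_of_bridge`**.
[cite: KozmaNitzan2024, §4 Lemma 10 Step IV (pp. 20–21), Lemma 11 (pp. 22–23), Lemma 12 (pp. 23–25), p. 30 (Step III)]
[cite: MartineauTassion2017, §3.2, §4.3 Lemma 4.2]
-/

noncomputable section

open MeasureTheory
open scoped Classical

namespace Summit.CriticalPhenomena.PercolationContinuityZ3.Theorems.Transplant

namespace Skelφ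

open Literature.Probability.Percolation Literature.Probability.LatticeModels SimpleGraph KNLevels ChainPlanar
open Literature.Barriers.CriticalPhenomena (graphBall graphBall_mono mem_graphBall_self)
open Skel (winGraph routeW)

variable {V : Type} [DecidableEq V] [Countable V] {G : SimpleGraph V} [G.LocallyFinite] {φ ψc ψL : V → Site 2}

/-- **THE ROUTE DATUM OF A FACE-STEP KIT FROM THE BRIDGE AND A BAND** (see the module docstring for the roles of the hypotheses).
[cite: KozmaNitzan2024, §4 Lemma 10 Step IV (pp. 20–21), Lemma 11 (pp. 22–23), Lemma 12 (pp. 23–25)] -/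
theorem faceRoute_of_bridge (hlipφ : Lip G φ) (hlipL : Lip G ψL) {w₀ c : V} {Rπ L : ℕ} {Wt : Sym2 V → unitInterval} {q : unitInterval}
    {D T Z : Finset V} (hWG : ∀ e, e ∉ G.edgeSet → Wt e = 0) (hWD : IsSubbox (winGraph G w₀ Rπ) Wt q D)
    (hDπ : ∀ u ∈ D, u ∈ graphBall G w₀ Rπ) (hcL : c ∈ graphBall G w₀ (Rπ - L)) (hLπ : L ≤ Rπ)
    -- the habitat and the target window of the face step, read in the cell map `ψc`
    {Pl : Finset (Site 2)} {MM : Finset V} (hPlD : Win G ψc w₀ Pl Rπ ⊆ D) (hMT : MM ⊆ T) (hMZ : Disjoint MM Z)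
    -- the pinned seed
    {S : Finset V} (hcS : c ∈ S) (hSconn : ∀ s ∈ S, PathIn G (↑S : Set V) c s) (hSD : S ⊆ D) (hSL : ∀ s ∈ S, s ∈ graphBall G c L)
    {σ : ℤ} (hσ : σ = 1 ∨ σ = -1) {kb : ℕ} (hSk : ∀ s ∈ S, |rootFrame φ c σ s 0| ≤ kb)
    -- the two frames and the chain data
    (B : BridgePrm) (hB : BridgeOK B) (S₂ : SchedFrame) (P₁ P₂ : WinChainData V) (hPo₁ : P₁.o = c) (hPo₂ : P₂.o = c)
    (hPS₁ : P₁.Sfin = D.filter fun y => y ∈ graphBall G c L) (hPS₂ : P₂.Sfin = D.filter fun y => y ∈ graphBall G c L)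
    (hRim₁ : ∀ k, P₁.Rim k ⊆ (planarWindowWin (lip_rootFrame hlipφ c hσ) c L).stepDF (B.bridgeFrame hB) k)
    (hRim₂ : ∀ k, P₂.Rim k ⊆ (planarWindowWin hlipL c L).stepDF S₂ k)
    (hRl₁ : P₁.Rlev + 1 ≤ B.R') (hRl₂ : P₂.Rlev + 1 ≤ S₂.R') (hj₁ : P₁.j₁ ≤ P₁.Rlev) (hj₂ : P₂.j₁ ≤ P₂.Rlev)
    -- rooms: footprints of the regions and of the last core, clearances, nonempty true targets, the cross link
    (hfoot₁ : ∀ w ∈ graphBall G c L, rootFrame φ c σ w ∈ Finset.Icc B.regionLo B.regionHi → ψc w ∈ Pl)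
    (hfoot₂ : ∀ k ≤ S₂.N, ∀ w ∈ graphBall G c L, ψL w ∈ S₂.region k → ψc w ∈ Pl)
    (hclear₁ : (kb : ℤ) < B.B₀lo 0 - B.R' - B.pr)
    (hclear₂ : ∀ k ≤ S₂.N, ∀ w ∈ graphBall G c L, ψL w ∈ S₂.region k → (kb : ℤ) < rootFrame φ c σ w 0)
    (hTne₁ : (Win G (rootFrame φ c σ) c (Finset.Icc B.core1Lo B.core1Hi) L).Nonempty)
    (hTne₂ : ∀ k ≤ S₂.N, (Win G ψL c (S₂.core (k + 1)) L).Nonempty)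
    (hx : ∀ w ∈ graphBall G c L, rootFrame φ c σ w ∈ Finset.Icc B.core1Lo B.core1Hi → ψL w ∈ S₂.core 0)
    (hlastf : ∀ w ∈ graphBall G c L, ψL w ∈ S₂.core (S₂.N + 1) → w ∈ MM)
    -- the hop: a `P_q`-link inside `U ⊆ D ∩ B(c, L)` from a sub-seed `S₀ ⊆ S ⊆ U` into the landing box
    {U S₀ T₀ : Finset V} (hUD : U ⊆ D) (hUL : ∀ u ∈ U, u ∈ graphBall G c L) (hS₀ : S₀ ⊆ S) (hSU : S ⊆ U)
    (hT₀ : ∀ w ∈ T₀, w ∈ graphBall G c L ∧ rootFrame φ c σ w ∈ Finset.Icc B.B₀lo B.B₀hi) {Δ' : ℕ} {δ ε η : ℝ}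
    (hlink : 1 - δ < (bondPercolation G q).real (linkIn (↑U : Set V) S₀ T₀))
    -- the chain property of the inner window graph at `(δ ↦ ε)`, length `1 + S₂.N`
    (hchain : ∀ (W : Sym2 V → unitInterval) (s : Fin (0 + 1 + S₂.N + 1) → TStep (winGraph G c L))
      (T' : Fin (0 + 1 + S₂.N + 1) → Finset V) (η : ℝ),
      (∀ i, (s i).L.o = (s 0).L.o) →
      (∀ i : Fin (0 + 1 + S₂.N), T' (Fin.castSucc i) ⊆ (s i.succ).L.X 0) →
      (∀ i, T' i ⊆ (s i).T) →
      (∀ i, (s i).KitsAt W q Δ' δ) →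
      η ≤ δ / 2 →
      (∀ i, (prodBernoulli W).real (⋃ t ∈ (s i).T \ T' i, openConn (s 0).L.o t) ≤ η) →
      1 - δ < (prodBernoulli W).real (s 0).L.reachB →
        1 - ε < (prodBernoulli W).real (⋃ t ∈ T' (Fin.last (0 + 1 + S₂.N)), openConn (s 0).L.o t))
    -- analytic inputs under the route law `routeW G Wt Qt S`, `Qt = D ∩ B(c, L)`: counts, kits, rim excess
    (hcount₁ : 1 / (1 - (q : ℝ)) ^ (Δ' * P₁.N) ≤ δ * ((Finset.Icc P₁.j₀ P₁.j₁).card : ℝ))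
    (hcount₂ : 1 / (1 - (q : ℝ)) ^ (Δ' * P₂.N) ≤ δ * ((Finset.Icc P₂.j₀ P₂.j₁).card : ℝ))
    (hkits₁ : ∀ k ≤ (B.bridgeFrame hB).N, ∀ j ∈ Finset.Icc P₁.j₀ P₁.j₁, ∃ (σk : SData V) (Sz : Finset V),
      SHyp (P₁.stepLF (planarWindowWin (lip_rootFrame hlipφ c hσ) c L) (B.bridgeFrame hB) k) j σk ∧ σk.N ≤ P₁.N ∧
      (1 - (q : ℝ) ^ σk.sB) ^ σk.k ≤ δ ∧ Sz ⊆ (P₁.stepLF (planarWindowWin (lip_rootFrame hlipφ c hσ) c L) (B.bridgeFrame hB) k).X j ∧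
      Sz ⊆ (planarWindowWin (lip_rootFrame hlipφ c hσ) c L).stepDF (B.bridgeFrame hB) k ∧
      (∀ x ∈ σk.K, ∀ e' ∈ σk.seed x, e' ∉ wireSet (↑Sz : Set V)) ∧ (∀ x ∈ σk.K, σk.face x ⊆ Sz) ∧
      (∀ x ∈ σk.K, 1 - 3 * δ ≤
        (prodBernoulli (routeW G Wt (D.filter fun y => y ∈ graphBall G c L) S)).real {ω | ∃ u ∈ σk.face x, 1 - δ <
          (prodBernoulli (pinW (routeW G Wt (D.filter fun y => y ∈ graphBall G c L) S) (wireSet (↑Sz : Set V)) ω)).real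
            (⋃ t' ∈ P₁.coreEF (planarWindowWin (lip_rootFrame hlipφ c hσ) c L) (B.bridgeFrame hB) k,
              openConnIn (↑((planarWindowWin (lip_rootFrame hlipφ c hσ) c L).stepDF (B.bridgeFrame hB) k) : Set V) u t')}))
    (hkits₂ : ∀ k ≤ S₂.N, ∀ j ∈ Finset.Icc P₂.j₀ P₂.j₁, ∃ (σk : SData V) (Sz : Finset V),
      SHyp (P₂.stepLF (planarWindowWin hlipL c L) S₂ k) j σk ∧ σk.N ≤ P₂.N ∧
      (1 - (q : ℝ) ^ σk.sB) ^ σk.k ≤ δ ∧ Sz ⊆ (P₂.stepLF (planarWindowWin hlipL c L) S₂ k).X j ∧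
      Sz ⊆ (planarWindowWin hlipL c L).stepDF S₂ k ∧
      (∀ x ∈ σk.K, ∀ e' ∈ σk.seed x, e' ∉ wireSet (↑Sz : Set V)) ∧ (∀ x ∈ σk.K, σk.face x ⊆ Sz) ∧
      (∀ x ∈ σk.K, 1 - 3 * δ ≤
        (prodBernoulli (routeW G Wt (D.filter fun y => y ∈ graphBall G c L) S)).real {ω | ∃ u ∈ σk.face x, 1 - δ <
          (prodBernoulli (pinW (routeW G Wt (D.filter fun y => y ∈ graphBall G c L) S) (wireSet (↑Sz : Set V)) ω)).real
            (⋃ t' ∈ P₂.coreEF (planarWindowWin hlipL c L) S₂ k, openConnIn (↑((planarWindowWin hlipL c L).stepDF S₂ k) : Set V) u t')}))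
    (hη : η ≤ δ / 2)
    (hexc₁ : ∀ k ≤ (B.bridgeFrame hB).N,
      (prodBernoulli (routeW G Wt (D.filter fun y => y ∈ graphBall G c L) S)).real (⋃ t' ∈ P₁.Rim k, openConn c t') ≤ η)
    (hexc₂ : ∀ k ≤ S₂.N, (prodBernoulli (routeW G Wt (D.filter fun y => y ∈ graphBall G c L) S)).real (⋃ t' ∈ P₂.Rim k, openConn c t') ≤ η) :
    ∃ Qt Ft : Finset V, Ft ⊆ T ∧ Qt ⊆ D ∧ Disjoint Ft Z ∧ 1 - ε < (prodBernoulli Wt).real (linkIn (↑Qt : Set V) S Ft) := by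
  set Qt := D.filter fun y => y ∈ graphBall G c L with hQt
  set 𝒲₁ := planarWindowWin (lip_rootFrame hlipφ c hσ) c L with h𝒲₁
  set 𝒲₂ := planarWindowWin hlipL c L with h𝒲₂
  set S₁ := B.bridgeFrame hB with hS₁
  -- the inner ball lies in the outer ball
  have hball : ∀ {w : V}, w ∈ graphBall G c L → w ∈ graphBall G w₀ Rπ := by
    intro w hw
    have h2 := BoxProdZ2.mem_graphBall_add G hcL hw
    rwa [Nat.sub_add_cancel hLπ] at h2
  have hQD : Qt ⊆ D := Finset.filter_subset _ _
  have hQL : ∀ u ∈ Qt, u ∈ graphBall G c L := fun u hu => (Finset.mem_filter.1 hu).2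
  -- footprints ⟹ the world
  have hW : ∀ {w : V}, w ∈ graphBall G c L → ψc w ∈ Pl → w ∈ Qt := by
    intro w hw hf
    exact Finset.mem_filter.2 ⟨hPlD ((mem_Win G ψc).2 ⟨hball hw, hf⟩), hw⟩
  have hSQ : S ⊆ Qt := fun s hs => Finset.mem_filter.2 ⟨hSD hs, hSL s hs⟩
  -- regions of the bridge / band: inside the world, off the seed
  have hDQ₁ : ∀ k ≤ S₁.N, 𝒲₁.stepDF S₁ k ⊆ Qt := by
    intro k hk w hw
    obtain rfl : k = 0 := Nat.le_zero.1 hk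
    change w ∈ Win G (rootFrame φ c σ) c (S₁.region 0) L at hw
    rw [mem_Win] at hw
    exact hW hw.1 (hfoot₁ w hw.1 (by simpa [hS₁] using hw.2))
  have hDQ₂ : ∀ k ≤ S₂.N, 𝒲₂.stepDF S₂ k ⊆ Qt := by
    intro k hk w hw
    change w ∈ Win G ψL c (S₂.region k) L at hw
    rw [mem_Win] at hw
    exact hW hw.1 (hfoot₂ k hk w hw.1 hw.2)
  have hDS₁ : ∀ k ≤ S₁.N, Disjoint S (𝒲₁.stepDF S₁ k) := by
    intro k hk
    obtain rfl : k = 0 := Nat.le_zero.1 hk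
    change Disjoint S (Win G (rootFrame φ c σ) c (S₁.region 0) L)
    refine Finset.disjoint_left.2 fun w hwS hw => ?_
    rw [mem_Win] at hw
    have h1 : B.B₀lo 0 - B.R' - B.pr ≤ rootFrame φ c σ w 0 := BridgePrm.le_of_mem_region (by simpa [hS₁] using hw.2) 0
    have h2 := (abs_le.1 (hSk w hwS)).2
    linarith
  have hDS₂ : ∀ k ≤ S₂.N, Disjoint S (𝒲₂.stepDF S₂ k) := by
    intro k hk
    change Disjoint S (Win G ψL c (S₂.region k) L)
    refine Finset.disjoint_left.2 fun w hwS hw => ?_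
    rw [mem_Win] at hw
    have h1 := hclear₂ k hk w hw.1 hw.2
    have h2 := (abs_le.1 (hSk w hwS)).2
    linarith
  -- nonempty true targets
  have hTne₁' : ∀ k ≤ S₁.N, (𝒲₁.coreTF S₁ k).Nonempty := by
    intro k hk
    obtain rfl : k = 0 := Nat.le_zero.1 hk
    change (Win G (rootFrame φ c σ) c (S₁.core (0 + 1)) L).Nonempty
    simpa [hS₁] using hTne₁
  have hTne₂' : ∀ k ≤ S₂.N, (𝒲₂.coreTF S₂ k).Nonempty := fun k hk => hTne₂ k hk
  -- the cross link and the last core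
  have hx' : 𝒲₁.coreTF S₁ S₁.N ⊆ 𝒲₂.W (S₂.core 0) := by
    intro w hw
    change w ∈ Win G (rootFrame φ c σ) c (S₁.core (S₁.N + 1)) L at hw
    change w ∈ Win G ψL c (S₂.core 0) L
    rw [mem_Win] at hw ⊢
    exact ⟨hw.1, hx w hw.1 (by simpa [hS₁] using hw.2)⟩
  have hlast : 𝒲₂.coreTF S₂ S₂.N ⊆ MM := by
    intro w hw
    change w ∈ Win G ψL c (S₂.core (S₂.N + 1)) L at hw
    rw [mem_Win] at hw
    exact hlastf w hw.1 hw.2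
  -- the last core misses the seed (it lies in a region off the seed)
  have hSF : Disjoint S (𝒲₂.coreTF S₂ S₂.N) :=
    (hDS₂ S₂.N le_rfl).mono_right (𝒲₂.coreTF_subset_stepDF S₂ le_rfl)
  -- the hop's target inside the first level
  have hT₀' : T₀ ⊆ 𝒲₁.W (S₁.core 0) := by
    intro w hw
    obtain ⟨hπ, hbox⟩ := hT₀ w hw
    change w ∈ Win G (rootFrame φ c σ) c (S₁.core 0) L
    rw [mem_Win]
    exact ⟨hπ, by simpa [hS₁] using hbox⟩
  have hUQ : U ⊆ Qt := fun u hu => Finset.mem_filter.2 ⟨hUD hu, hUL u hu⟩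
  have hN : S₁.N + 1 + S₂.N = 0 + 1 + S₂.N := by simp [hS₁]
  have hRl₁' : P₁.Rlev + 1 ≤ S₁.R' := by simpa [hS₁] using hRl₁
  -- assemble
  refine ⟨Qt, 𝒲₂.coreTF S₂ S₂.N, hlast.trans hMT, hQD, hMZ.mono_left hlast, ?_⟩
  exact linkIn_of_chain₂ hWG hWD hDπ hQD hQL hSQ hcS hSconn 𝒲₁ 𝒲₂ S₁ S₂ P₁ P₂ hPo₁ hPo₂ hPS₁ hPS₂ hRl₁' hRim₁ hTne₁' hRl₂ hRim₂ hTne₂'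
    hj₁ hj₂ hDQ₁ hDQ₂ hDS₁ hDS₂ hx' subset_rfl hSF hUQ hS₀ hSU hT₀' hlink (hN ▸ hchain) hcount₁ hcount₂ hkits₁ hkits₂ hη
    hexc₁ hexc₂

end Skelφ

end Summit.CriticalPhenomena.PercolationContinuityZ3.Theorems.Transplant

end
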